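import Summits.Schanuel.Schanuel.Theorems.ZilberEacBranchAlgebraic
import Summits.Schanuel.Schanuel.Theorems.ZilberEacGraphSimpleTopRowTools
import Mathlib.FieldTheory.Separable
import Mathlib.FieldTheory.IsAlgClosed.Basic
import HarnessLib

/-!
# The equimodular class, XXIX: THEOREM EB — over EVERY polynomial graph of degree `≥ 2`, a fibre
# curve with SIMPLE TOP ROW and non-constant extreme-row ratio is dense (all `y₀`-degrees)

HONEST FRAMING.  Cell `pub-schanuel` (Zilber's Exponential-Algebraic Closedness, case ladder;
host summit Schanuel), seat 2, gen 24.  **`unprojectedDense_graph_simpleTopRow`** (THEOREM EB,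
"every branch"): let `p ∈ ℂ[X]` have degree `≥ 2` and let `P(x₀, y₀) = Σ_j q_j(x₀) y₀^j` be an
irreducible fibre polynomial of `y₀`-degree `r` whose rows have degree `≤ N`, whose TOP ROW
`T = Σ_j [x₀^N]q_j · X^j` has `r` distinct nonzero roots (`T` separable, `deg T = r`, `T(0) ≠ 0`), and
whose extreme rows have non-constant ratio (`q_0 ≠ c·q_r`).  Then the surface
`{x₁ = p(x₀), P(x₀, y₀) = 0} ⊆ ℂ² × (ℂˣ)²` has Zariski-dense exponential points.  Proof — the
ALL-BRANCHES TRICK: if not, file XXVII makes `log(ρ_θ/θ)` algebraic over `ℂ(z)` (as a germ at one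
large real point `z₀`) for EVERY analytic branch `ρ_θ(z) = ψ_θ(1/z)` at infinity, `θ` running over
the roots of `T`; the `r` values `ρ_θ(z)` are the distinct roots of `P(z, ·)`, so by Vieta
`∏_θ ρ_θ = (-1)^r q_0/q_r` and `L = Σ_θ log(ρ_θ/θ)` is an algebraic primitive of the logarithmic
derivative of the NON-CONSTANT RATIONAL function `q_0/q_r` — contradicting gen 22 file II
(`not_algebraic_of_hasDerivAt_logDeriv`, after a coprime reduction).  The transcendence of the
logarithm of a single ALGEBRAIC branch (valuation theory, not in the tree) is thereby circumvented.
This decides, inside gen 23's residual class (two distinct positive `y₀`-degrees), every member with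
simple top row and `q_0/q_r` non-constant; the reciprocal-type members (`q_0 = c·q_r`) and multiple
top-row roots remain OPEN, as do Mantova–Masser's question in general (PLMS 2024 §1 p. 5) and
EC(3,2); NOT Schanuel's conjecture (neither used nor implied; EAC ⇏ SC).
-/

noncomputable section

open Filter Topology Set Complex MvPolynomial
open Literature.NumberTheory.Transcendental Literature.ModelTheory.Zilber
open Literature.ModelTheory.ExponentialFields

set_option linter.dupNamespace false

namespace Summit.Schanuel.Schanuel.Theorems

/-- **THEOREM EB (every branch): simple top row and non-constant extreme-row ratio ⟹ dense, over
every polynomial graph of degree `≥ 2`.**  See the module docstring.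
[cite: MantovaMasser2023, §1 Further remarks, p. 5 (the question, open in general)] (new) -/
theorem unprojectedDense_graph_simpleTopRow (Q : Polynomial (Polynomial ℂ))
    {P : MvPolynomial (Fin 2) ℂ}
    (hP : ∀ x y : ℂ, MvPolynomial.eval ![x, y] P = (Q.map (Polynomial.evalRingHom x)).eval y)
    (hirr : Irreducible P) (N : ℕ) (hN : ∀ j, (Q.coeff j).natDegree ≤ N) (T : Polynomial ℂ)
    (hT : ∀ j, T.coeff j = (Q.coeff j).coeff N) (hTdeg : T.natDegree = Q.natDegree)
    (hTsep : T.Separable) (hT00 : T.eval 0 ≠ 0)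
    (hratio : ∀ c : ℂ, Q.coeff 0 ≠ Polynomial.C c * Q.coeff Q.natDegree)
    (p : Polynomial ℂ) (hd : 2 ≤ p.natDegree) :
    UnprojectedDense {w : Fin 2 ⊕ Fin 2 → ℂ | w (Sum.inl 1) = p.eval (w (Sum.inl 0)) ∧
      MvPolynomial.eval ![w (Sum.inl 0), w (Sum.inr 0)] P = 0} := by
  classical
  by_contra hnot
  set r := Q.natDegree with hr
  set A₀ : Polynomial ℂ := Q.coeff r with hA₀
  set B₀ : Polynomial ℂ := Q.coeff 0 with hB₀
  have hT0 : T ≠ 0 := fun h => hT00 (by rw [h, Polynomial.eval_zero])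
  -- the extreme rows are nonzero of degree `N`
  have hA₀N : A₀.coeff N ≠ 0 := by
    have h := Polynomial.leadingCoeff_ne_zero.2 hT0
    rw [Polynomial.leadingCoeff, hTdeg, hT] at h
    exact h
  have hA₀0 : A₀ ≠ 0 := fun h => hA₀N (by rw [h, Polynomial.coeff_zero])
  have hB₀N : B₀.coeff N ≠ 0 := by
    rw [hB₀, ← hT, Polynomial.coeff_zero_eq_eval_zero]; exact hT00
  have hB₀0 : B₀ ≠ 0 := fun h => hB₀N (by rw [h, Polynomial.coeff_zero])
  have hQlc : Q.leadingCoeff = A₀ := rfl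
  have hratio' : ∀ c : ℂ, B₀ ≠ Polynomial.C c * A₀ := fun c => hratio c
  -- the roots of `T`: `r` of them, nonzero and simple
  set F : Finset ℂ := T.roots.toFinset with hF
  have hFmem : ∀ θ ∈ F, T.IsRoot θ := fun θ hθ => by
    rw [hF, Multiset.mem_toFinset, Polynomial.mem_roots hT0] at hθ; exact hθ
  have hFcard : F.card = r := by
    rw [hF, Multiset.toFinset_card_of_nodup (Polynomial.nodup_roots hTsep),
      ← (IsAlgClosed.splits T).natDegree_eq_card_roots, hTdeg]
  have hFne : ∀ θ ∈ F, θ ≠ 0 := by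
    intro θ hθ h
    have := (hFmem θ hθ).eq_zero
    rw [h] at this
    exact hT00 this
  have hFsimple : ∀ θ ∈ F, (Polynomial.derivative T).eval θ ≠ 0 := by
    intro θ hθ hd0
    obtain ⟨u, v, huv⟩ := (Polynomial.separable_def T).1 hTsep
    have := congrArg (Polynomial.eval θ) huv
    rw [Polynomial.eval_add, Polynomial.eval_mul, Polynomial.eval_mul, (hFmem θ hθ).eq_zero, hd0,
      mul_zero, mul_zero, add_zero, Polynomial.eval_one] at this
    exact zero_ne_one this
  -- per-branch data (file XXVII)
  have hbr : ∀ θ ∈ F, ∃ (ψ : ℂ → ℂ) (δ : ℝ), 0 < δ ∧ ψ 0 = θ ∧ AnalyticAt ℂ ψ 0 ∧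
      (∀ u : ℂ, ‖u‖ < δ → AnalyticAt ℂ ψ u ∧ ψ u ≠ 0 ∧ ψ u / θ ∈ Complex.slitPlane) ∧
      (∀ u : ℂ, ‖u‖ < δ → u ≠ 0 → (Q.map (Polynomial.evalRingHom u⁻¹)).eval (ψ u) = 0) ∧
      (∀ u y : ℂ, ‖u‖ < δ → ‖y - θ‖ < δ → u ≠ 0 →
        (Q.map (Polynomial.evalRingHom u⁻¹)).eval y = 0 → y = ψ u) ∧
      (∀ z₀ : ℂ, δ⁻¹ < ‖z₀‖ → ∃ hL : AnalyticAt ℂ (fun z => Complex.log (ψ z⁻¹ / θ)) z₀,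
        IsAlgebraic (Algebra.adjoin ℂ ({zGerm z₀} : Set (AGerm z₀))) (AGerm.mk z₀ hL)) :=
    fun θ hθ => exists_algebraic_branchLog_of_not_dense Q hP hirr N hN T hT hT0 (hFne θ hθ)
      (hFmem θ hθ) (hFsimple θ hθ) p hd hnot
  choose! ψ δ hδ hψ0 hψan hψball hψroot hψuniq hψalg using hbr
  -- separation of the branches: `ψ_θ` stays within `‖θ - θ'‖/2` of `θ`
  have hsep : ∀ θ ∈ F, ∀ θ' ∈ F, θ ≠ θ' → ∃ δ' : ℝ, 0 < δ' ∧
      ∀ u : ℂ, ‖u‖ < δ' → ‖ψ θ u - θ‖ < ‖θ - θ'‖ / 2 := by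
    intro θ hθ θ' hθ' hne
    have hc := (hψan θ hθ).continuousAt
    have hpos : 0 < ‖θ - θ'‖ / 2 := half_pos (norm_pos_iff.2 (sub_ne_zero.2 hne))
    obtain ⟨δ', hδ', h⟩ := Metric.continuousAt_iff.1 hc _ hpos
    refine ⟨δ', hδ', fun u hu => ?_⟩
    have := h (by rwa [dist_zero_right])
    rwa [hψ0 θ hθ, dist_eq_norm] at this
  choose! δ₂ hδ₂ hsep' using hsep
  -- a radius beyond the roots of `A₀ B₀` and all the inverse radii
  obtain ⟨R₀, hR₀⟩ : ∃ R₀ : ℝ, ∀ z : ℂ, (A₀ * B₀).IsRoot z → ‖z‖ ≤ R₀ := by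
    obtain ⟨C, hC⟩ := ((A₀ * B₀).roots.toFinset.finite_toSet.isBounded).exists_norm_le
    exact ⟨C, fun z hz => hC z (by
      simpa [Multiset.mem_toFinset, Polynomial.mem_roots (mul_ne_zero hA₀0 hB₀0)] using hz)⟩
  set R : ℝ := max R₀ 0 + ∑ θ ∈ F, (δ θ)⁻¹ + ∑ q ∈ F.offDiag, (δ₂ q.1 q.2)⁻¹ with hRdef
  have hS1 : 0 ≤ ∑ θ ∈ F, (δ θ)⁻¹ :=
    Finset.sum_nonneg fun θ hθ => (inv_pos.2 (hδ θ hθ)).le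
  have hS2 : 0 ≤ ∑ q ∈ F.offDiag, (δ₂ q.1 q.2)⁻¹ := by
    refine Finset.sum_nonneg fun q hq => ?_
    rw [Finset.mem_offDiag] at hq
    exact (inv_pos.2 (hδ₂ q.1 hq.1 q.2 hq.2.1 hq.2.2)).le
  have hRR₀ : R₀ ≤ R := by
    have := le_max_left R₀ 0; linarith
  have hR0 : 0 ≤ R := by
    have := le_max_right R₀ 0; linarith
  have hRδ : ∀ θ ∈ F, (δ θ)⁻¹ ≤ R := by
    intro θ hθ
    have h1 : (δ θ)⁻¹ ≤ ∑ θ ∈ F, (δ θ)⁻¹ :=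
      Finset.single_le_sum (f := fun θ => (δ θ)⁻¹) (fun θ' hθ' => (inv_pos.2 (hδ θ' hθ')).le) hθ
    have := le_max_right R₀ 0; linarith
  have hRδ₂ : ∀ θ ∈ F, ∀ θ' ∈ F, θ ≠ θ' → (δ₂ θ θ')⁻¹ ≤ R := by
    intro θ hθ θ' hθ' hne
    have hmem : (θ, θ') ∈ F.offDiag := Finset.mem_offDiag.2 ⟨hθ, hθ', hne⟩
    have h1 : (δ₂ θ θ')⁻¹ ≤ ∑ q ∈ F.offDiag, (δ₂ q.1 q.2)⁻¹ :=
      Finset.single_le_sum (f := fun q : ℂ × ℂ => (δ₂ q.1 q.2)⁻¹) (fun q hq => by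
        rw [Finset.mem_offDiag] at hq
        exact (inv_pos.2 (hδ₂ q.1 hq.1 q.2 hq.2.1 hq.2.2)).le) hmem
    have := le_max_right R₀ 0; linarith
  -- what holds at every `z` with `‖z‖ > R`
  have hinvlt : ∀ z : ℂ, R < ‖z‖ → ∀ d : ℝ, 0 < d → d⁻¹ ≤ R → ‖z⁻¹‖ < d := by
    intro z hz d hd hdR
    have hzpos : 0 < ‖z‖ := lt_of_le_of_lt hR0 hz
    rw [norm_inv]
    calc ‖z‖⁻¹ < (d⁻¹)⁻¹ := (inv_lt_inv₀ hzpos (by positivity)).2 (lt_of_le_of_lt hdR hz)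
      _ = d := inv_inv d
  have hgood : ∀ z : ℂ, R < ‖z‖ → z ≠ 0 ∧ A₀.eval z ≠ 0 ∧ B₀.eval z ≠ 0 ∧
      (∀ θ ∈ F, AnalyticAt ℂ (ψ θ) z⁻¹ ∧ ψ θ z⁻¹ ≠ 0 ∧ ψ θ z⁻¹ / θ ∈ Complex.slitPlane ∧
        (Q.map (Polynomial.evalRingHom z)).eval (ψ θ z⁻¹) = 0) ∧
      (∀ θ ∈ F, ∀ θ' ∈ F, θ ≠ θ' → ψ θ z⁻¹ ≠ ψ θ' z⁻¹) := by
    intro z hz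
    have hz0 : z ≠ 0 := norm_pos_iff.1 (lt_of_le_of_lt hR0 hz)
    have hAB : ¬ (A₀ * B₀).IsRoot z := fun h => absurd (lt_of_le_of_lt hRR₀ hz) (not_lt.2 (hR₀ z h))
    rw [Polynomial.IsRoot, Polynomial.eval_mul, mul_eq_zero, not_or] at hAB
    refine ⟨hz0, hAB.1, hAB.2, fun θ hθ => ?_, fun θ hθ θ' hθ' hne heq => ?_⟩
    · have hu : ‖z⁻¹‖ < δ θ := hinvlt z hz (δ θ) (hδ θ hθ) (hRδ θ hθ)
      obtain ⟨han, hne, hslit⟩ := hψball θ hθ z⁻¹ hu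
      have hroot := hψroot θ hθ z⁻¹ hu (inv_ne_zero hz0)
      rw [inv_inv] at hroot
      exact ⟨han, hne, hslit, hroot⟩
    · have h1 := hsep' θ hθ θ' hθ' hne z⁻¹ (hinvlt z hz _ (hδ₂ θ hθ θ' hθ' hne) (hRδ₂ θ hθ θ' hθ' hne))
      have h2 := hsep' θ' hθ' θ hθ (Ne.symm hne) z⁻¹
        (hinvlt z hz _ (hδ₂ θ' hθ' θ hθ (Ne.symm hne)) (hRδ₂ θ' hθ' θ hθ (Ne.symm hne)))
      rw [heq] at h1
      have h3 : ‖θ - θ'‖ ≤ ‖ψ θ' z⁻¹ - θ‖ + ‖ψ θ' z⁻¹ - θ'‖ := by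
        have := norm_sub_le (ψ θ' z⁻¹ - θ') (ψ θ' z⁻¹ - θ)
        rw [show ψ θ' z⁻¹ - θ' - (ψ θ' z⁻¹ - θ) = θ - θ' by ring] at this
        linarith
      rw [norm_sub_rev θ' θ] at h2
      linarith
  -- Vieta at every large `z`: `∏_θ ψ_θ(1/z) = (-1)^r q_0(z)/q_r(z)`
  have hvieta : ∀ z : ℂ, R < ‖z‖ → ∏ θ ∈ F, ψ θ z⁻¹ = (-1) ^ r * B₀.eval z / A₀.eval z := by
    intro z hz
    obtain ⟨hz0, hAz, hBz, hbranch, hdist⟩ := hgood z hz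
    set Qz : Polynomial ℂ := Q.map (Polynomial.evalRingHom z) with hQz
    have hlcz : (Polynomial.evalRingHom z) Q.leadingCoeff ≠ 0 := by
      rw [hQlc, Polynomial.coe_evalRingHom]; exact hAz
    have hQz_deg : Qz.natDegree = r := Polynomial.natDegree_map_of_leadingCoeff_ne_zero _ hlcz
    have hQz_lc : Qz.leadingCoeff = A₀.eval z := by
      rw [hQz, Polynomial.leadingCoeff_map_of_leadingCoeff_ne_zero _ hlcz, hQlc, Polynomial.coe_evalRingHom]
    have hQz0 : Qz ≠ 0 := by
      intro h; rw [h, Polynomial.leadingCoeff_zero] at hQz_lc; exact hAz hQz_lc.symm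
    have hinj : Set.InjOn (fun θ => ψ θ z⁻¹) F := by
      intro θ hθ θ' hθ' heq
      by_contra hne
      exact hdist θ hθ θ' hθ' hne heq
    set s : Finset ℂ := F.image (fun θ => ψ θ z⁻¹) with hs
    have hscard : s.card = Qz.natDegree := by
      rw [hs, Finset.card_image_of_injOn hinj, hFcard, hQz_deg]
    have hsroot : ∀ y ∈ s, Qz.IsRoot y := by
      intro y hy
      obtain ⟨θ, hθ, rfl⟩ := Finset.mem_image.1 hy
      exact (hbranch θ hθ).2.2.2
    have hev := eval_zero_eq_of_roots Qz hQz0 s hsroot hscard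
    have hQz_ev0 : Qz.eval 0 = B₀.eval z := by
      rw [← Polynomial.coeff_zero_eq_eval_zero, hQz, Polynomial.coeff_map, Polynomial.coe_evalRingHom]
    rw [hQz_ev0, hQz_lc, hs, Finset.prod_image hinj, Finset.card_image_of_injOn hinj, hFcard] at hev
    have h1 : ((-1 : ℂ) ^ r) * (-1) ^ r = 1 := by
      rw [← mul_pow, neg_mul_neg, one_mul, one_pow]
    rw [eq_div_iff hAz]
    linear_combination (-(-1 : ℂ) ^ r) * hev + (-(∏ θ ∈ F, ψ θ z⁻¹) * A₀.eval z) * h1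
  -- the coprime reduction of `q_0/q_r` (hypothesis of gen 22 file II)
  obtain ⟨A, B, hA, hB, ⟨a, ha⟩, hABne, hlogeq⟩ := exists_coprime_logDeriv hA₀0 hB₀0 hratio'
  -- a large real point
  set z₀ : ℂ := ((R + 1 : ℝ) : ℂ) with hz₀def
  have hz₀ : R < ‖z₀‖ := by
    rw [hz₀def, Complex.norm_real, Real.norm_eq_abs, abs_of_pos (by linarith)]; linarith
  have hnear : ∀ᶠ y in 𝓝 z₀, R < ‖y‖ :=
    (continuous_norm.continuousAt (x := z₀)).eventually (lt_mem_nhds hz₀)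
  have hz₀δ : ∀ θ ∈ F, (δ θ)⁻¹ < ‖z₀‖ := fun θ hθ => lt_of_le_of_lt (hRδ θ hθ) hz₀
  -- the sum of the logarithms of the branches: analytic and algebraic at `z₀`
  have hLθ : ∀ θ ∈ F, AnalyticAt ℂ (fun y => Complex.log (ψ θ y⁻¹ / θ)) z₀ :=
    fun θ hθ => (hψalg θ hθ z₀ (hz₀δ θ hθ)).fst
  set L : ℂ → ℂ := fun y => ∑ i ∈ F.attach, Complex.log (ψ i.1 y⁻¹ / i.1) with hLdef
  have hLan : AnalyticAt ℂ L z₀ := Finset.analyticAt_fun_sum _ fun i _ => hLθ i.1 i.2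
  have hLO : AGerm.mk z₀ hLan = ∑ i ∈ F.attach, AGerm.mk z₀ (hLθ i.1 i.2) :=
    AGerm.mk_finset_sum F.attach (f := fun i y => Complex.log (ψ i.1 y⁻¹ / i.1))
      (fun i => hLθ i.1 i.2) hLan
  have hLalg : IsAlgebraic (Algebra.adjoin ℂ ({zGerm z₀} : Set (AGerm z₀))) (AGerm.mk z₀ hLan) := by
    rw [hLO]
    exact isAlgebraic_finset_sum _ fun i _ => (hψalg i.1 i.2 z₀ (hz₀δ i.1 i.2)).snd
  obtain ⟨Prel, hPrel0, hPrel⟩ := exists_polyPoly_relation hLalg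
  -- its derivative is the logarithmic derivative of the rational function `q_0/q_r`
  have hL : ∀ᶠ y in 𝓝 z₀, HasDerivAt L
      ((A * Polynomial.derivative B - Polynomial.derivative A * B).eval y / (A * B).eval y) y := by
    have hnear2 := eventually_eventually_nhds.2 hnear
    filter_upwards [hnear, hnear2] with y hy hyy
    obtain ⟨hy0, hAy, hBy, hbranch, -⟩ := hgood y hy
    -- each logarithm
    have hterm : ∀ θ ∈ F, HasDerivAt (fun x => Complex.log (ψ θ x⁻¹ / θ))
        (deriv (fun x => ψ θ x⁻¹) y / ψ θ y⁻¹) y := by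
      intro θ hθ
      obtain ⟨han, hne, hslit, -⟩ := hbranch θ hθ
      have hρan : AnalyticAt ℂ (fun x => ψ θ x⁻¹) y := han.comp (analyticAt_inv hy0)
      have h := (hρan.differentiableAt.hasDerivAt.div_const θ).clog hslit
      refine h.congr_deriv ?_
      have hθ0 := hFne θ hθ
      field_simp
    have hsum : HasDerivAt L (∑ i ∈ F.attach, deriv (fun x => ψ i.1 x⁻¹) y / ψ i.1 y⁻¹) y :=
      HasDerivAt.fun_sum fun i _ => hterm i.1 i.2
    refine hsum.congr_deriv ?_
    rw [Finset.sum_attach F (fun θ => deriv (fun x => ψ θ x⁻¹) y / ψ θ y⁻¹)]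
    have hABy : (A₀ * B₀).eval y ≠ 0 := by
      rw [Polynomial.eval_mul]; exact mul_ne_zero hAy hBy
    rw [← hlogeq y hABy]
    refine sum_deriv_div_eq_logDeriv F (f := fun θ x => ψ θ x⁻¹)
      (fun θ hθ => (hbranch θ hθ).1.comp (analyticAt_inv hy0)) (fun θ hθ => (hbranch θ hθ).2.1)
      A₀ B₀ ((-1) ^ r) hAy hBy (pow_ne_zero _ (neg_ne_zero.2 one_ne_zero)) ?_
    filter_upwards [hyy] with x hx using hvieta x hx
  have h0 : (A * B).eval z₀ ≠ 0 := by
    refine hABne z₀ ?_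
    obtain ⟨-, hAz, hBz, -⟩ := hgood z₀ hz₀
    rw [Polynomial.eval_mul]; exact mul_ne_zero hAz hBz
  exact not_algebraic_of_hasDerivAt_logDeriv hA hB ha hLan hL h0 hPrel0 hPrel

end Summit.Schanuel.Schanuel.Theorems
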